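import Literature.NumberTheory.EllipticCurves.TwoIsogenySelmerGroupShaParity
import Literature.NumberTheory.EllipticCurves.TwoIsogenyTorsorImage
import Literature.NumberTheory.EllipticCurves.TwoIsogenyDualKernel
import Literature.NumberTheory.EllipticCurves.CasselsTateIsogenyParity
import Literature.NumberTheory.EllipticCurves.IsogenyDualProofs
import Literature.NumberTheory.EllipticCurves.ShaIsogenyProofs
import Literature.NumberTheory.EllipticCurves.IsogenyPairParity
import Literature.NumberTheory.EllipticCurves.ZpCorankStable
import Literature.GroupTheory.FiniteAbelian.IsogenyPairParityFinite
import Literature.NumberTheory.EllipticCurves.CasselsTatePairingFunctorial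
import HarnessLib

/-!
# Cassels' parity formula for the `2`-isogeny from a functorial Cassels–Tate pairing
# (Dokchitser–Dokchitser 2011, Thm. 30; Cassels 1965; Milne, *ADT*, I.6.9, 6.10(a), 6.13(a))

The tree's named fact `cassels_selmerCorank_two_parity` — for `E = E_{a,b} : y² = x³ + ax² + bx` over `ℚ`,
`(-1)^{corank Sel_{2^∞}(E/ℚ)} = (-1)^{dim S + dim S'}` — is reduced in `TwoIsogenySelmerGroupShaParity.lean`
(`cassels_selmerCorank_two_parity_iff_sha_parity`) to a statement about `Ш` alone, and the two factors
there are kernels of `Ш` along the explicit `2`-isogenies (`natCard_sha_inf_range_twoIsogenyTorsorHom_eq`).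
This file closes the remaining gap *from the Cassels–Tate pairing*: granted, for the pair
`φ₀ : V₀ → E` (explicit `2`-isogeny of the half-model `V₀ ≅ E'`) and its dual `φ̂₀ : E → V₀`, bi-additive
alternating pairings on `Ш(V₀)` and `Ш(E)` with kernels in the divisible subgroups and ADJOINT
(`⟨φ₀ x, y⟩_E = ⟨x, φ̂₀ y⟩_{V₀}`: Milne, *ADT*, I, Rem. 6.10(a), with `E^t = E`, `φ^t = φ̂` for elliptic
curves), Cassels' parity formula holds. The inputs are assembled from

* `CasselsTateIsogenyParity.exists_natCard_ker_shaMap_even_shaCorank` (the `Ш`-part: `corank Ш(E)[2^∞] +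
  dim ker Ш(φ₀) + dim ker Ш(φ̂₀)` even, from the abstract isogeny-pair parity `habs`),
* `TwoIsogenyDualKernel.ker_shaMap_eq_of_comp_twoIsogeny` (`ker Ш(φ̂₀) = ker Ш(φ_E)`),
* `TwoIsogenyTorsorImage.natCard_sha_inf_range_twoIsogenyTorsorHom_eq`, and the reduction
  `cassels_selmerCorank_two_parity_iff_sha_parity`.

Main statements:

* `exists_natCard_sha_inf_range_even_shaCorank` — for any `V` in two-torsion normal form over a number
  field: `#(Ш(V) ∩ im Ξ_V) = 2^m`, `#(Ш(V') ∩ im Ξ_{V'}) = 2^n`, `corank Ш(V')[2^∞] + m + n` even, granted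
  adjoint Cassels–Tate data for `(φ_V, φ̂_V)` and the abstract parity.
* `cassels_selmerCorank_two_parity_of_casselsTate_functorial` — **Cassels' parity formula over `ℚ` from
  a functorial Cassels–Tate family** (the body of the named fact-to-be `casselsTate_pairing_functorial`:
  alternating, kernel = divisible subgroup, `⟨φ x, y⟩_{W'} = ⟨x, φ̂ y⟩_W` for every isogeny with dual
  `φ̂ φ = deg φ`) and the abstract parity; `isogenyPairParity` discharges the latter from the tree
  (`IsogenyPairParity`, `IsogenyPairParityFinite`, `ZpCorankStable`), giving the primed version
  `cassels_selmerCorank_two_parity_of_casselsTate_functorial'` whose ONLY hypothesis is the pairing family.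

## References

* T. Dokchitser, V. Dokchitser, Root numbers and parity of ranks of elliptic curves, J. reine angew.
  Math. 658 (2011), 39–64, Thm. 30 ("Cassels' formula") = arXiv:0906.1815 Thm. 30.
  [DokchitserDokchitser2011Crelle]
* J. W. S. Cassels, Arithmetic on curves of genus 1. VIII, J. reine angew. Math. 217 (1965), 180–199.
  [Cassels1965ArithmeticVIII]
* J. S. Milne, *Arithmetic Duality Theorems*, 2nd ed. (2006), I, Prop. 6.9, Rem. 6.10(a), Thm. 6.13(a).
  [MilneADT2006]
* J. H. Silverman, *The Arithmetic of Elliptic Curves*, 2nd ed. (2009), III.6.1, X.4.2(a), X.4.9, X.4.14.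
  [SilvermanAEC2009]

## Design

Theorems only; no named fact is introduced here: the Cassels–Tate data enter as hypotheses (pairings and
their adjointness, or the functorial-family body over `ℚ`), and the group theory as the hypothesis `habs`
(= the conclusion shape of `exists_natCard_ker_even_zpCorank_of_adjoint`, with `Ш ⊆ H¹` in the universe
`u` of `K` and the values `ℚ/ℤ` in `Type`).
-/

noncomputable section

open scoped Classical
open scoped AddSubgroup

namespace Literature.NumberTheory.EllipticCurves

open _root_.WeierstrassCurve

universe u

section General

variable {K : Type u} [Field K] [NumberField K] (V : WeierstrassCurve K) [V.IsTwoTorsionNF] [V.IsElliptic]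

/-- Transport of `#(Ш(X) ∩ im Ξ_X)` along an equality of curves (the instances are propositions).
[folklore] -/
theorem natCard_sha_inf_range_twoIsogenyTorsorHom_congr {X Y : WeierstrassCurve K}
    [hX₁ : X.IsTwoTorsionNF] [hX₂ : X.IsElliptic] [hY₁ : Y.IsTwoTorsionNF] [hY₂ : Y.IsElliptic] (h : X = Y) :
    Nat.card ↥(X.sha ⊓ AddMonoidHom.range (G := Additive (Affine.SqUnits K)) X.twoIsogenyTorsorHom) =
      Nat.card ↥(Y.sha ⊓ AddMonoidHom.range (G := Additive (Affine.SqUnits K)) Y.twoIsogenyTorsorHom) := by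
  subst h
  rfl

omit [V.IsTwoTorsionNF] [V.IsElliptic] in
/-- Transport of `corank Ш(X)[p^∞]` along an equality of curves. [folklore] -/
theorem shaCorank_congr {X Y : WeierstrassCurve K} (h : X = Y) (p : ℕ) : X.shaCorank p = Y.shaCorank p := by
  subst h
  rfl

variable {V} in
/-- **The two `Ш`-kernels of the descent via `2`-isogeny and the corank, from adjoint Cassels–Tate data.**
For `V` in two-torsion normal form over a number field, `φ = φ_V : V → V'` and `ψ : V' → V` equivariant
with local points maps and `ψ ∘ φ = [2]` (the dual isogeny), and bi-additive alternating pairings on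
`Ш(V)`, `Ш(V')` with kernels in the divisible subgroups, adjoint for `(Ш(φ), Ш(ψ))`: then
`#(Ш(V) ∩ im Ξ_V) = 2^m`, `#(Ш(V') ∩ im Ξ_{V'}) = 2^n` and `corank Ш(V')[2^∞] + m + n` is even.
[cite: DokchitserDokchitser2011Crelle, Thm. 30 (arXiv:0906.1815)] -/
theorem exists_natCard_sha_inf_range_even_shaCorank
    (habs : ∀ {A A' : Type u} {Q : Type} [AddCommGroup A] [AddCommGroup A'] [AddCommGroup Q]
      (p : ℕ) [Fact p.Prime]
      (_hA : ∀ a : A, ∃ n : ℕ, p ^ n • a = 0) (_hA' : ∀ a : A', ∃ n : ℕ, p ^ n • a = 0)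
      [Finite A[(p : ℤ)]] [Finite A'[(p : ℤ)]]
      (ι : Q[(p : ℤ)] →+ ZMod p) (_hι : Function.Injective ι)
      (B : A →+ A →+ Q) (B' : A' →+ A' →+ Q) (_hB : ∀ x, B x x = 0) (_hB' : ∀ y, B' y y = 0)
      (_hker : ∀ a, (∀ b, B a b = 0) → ∀ k : ℕ, a ∈ (nsmulAddMonoidHom (α := A) (p ^ k)).range)
      (_hker' : ∀ a, (∀ b, B' a b = 0) → ∀ k : ℕ, a ∈ (nsmulAddMonoidHom (α := A') (p ^ k)).range)
      (f : A →+ A') (g : A' →+ A) (_hgf : ∀ x, g (f x) = p • x) (_hfg : ∀ y, f (g y) = p • y)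
      (_hadj : ∀ x y, B' (f x) y = B x (g y)),
      ∃ m n : ℕ, Nat.card f.ker = p ^ m ∧ Nat.card g.ker = p ^ n ∧ Even (zpCorank A' p + m + n))
    (ψ : V.twoIsogenyCodomain.geomPoints →+ V.geomPoints)
    (hψs : ∀ (σ : Field.absoluteGaloisGroup K) (P : V.twoIsogenyCodomain.geomPoints), ψ (σ • P) = σ • ψ P)
    (hlocψ : HasLocalPointsMaps V.twoIsogenyCodomain V ψ)
    (hψ : ∀ P : V.geomPoints, ψ (V.twoIsogenyGeomHom P) = (2 : ℤ) • P)
    (B : V.sha →+ V.sha →+ AddCircle (1 : ℚ))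
    (B' : V.twoIsogenyCodomain.sha →+ V.twoIsogenyCodomain.sha →+ AddCircle (1 : ℚ))
    (hB : ∀ x, B x x = 0) (hB' : ∀ y, B' y y = 0)
    (hBker : ∀ x, (∀ y, B x y = 0) → x ∈ AddSubgroup.divisibleElements V.sha)
    (hB'ker : ∀ x, (∀ y, B' x y = 0) → x ∈ AddSubgroup.divisibleElements V.twoIsogenyCodomain.sha)
    (hadj : ∀ x y, B' (shaMap V.twoIsogenyGeomHom (twoIsogenyGeomHom_smul V)
      V.twoIsogeny.hasLocalPointsMaps_toAddMonoidHom x) y = B x (shaMap ψ hψs hlocψ y)) :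
    ∃ m n : ℕ,
      Nat.card ↥(V.sha ⊓ AddMonoidHom.range (G := Additive (Affine.SqUnits K)) V.twoIsogenyTorsorHom) = 2 ^ m ∧
      Nat.card ↥(V.twoIsogenyCodomain.sha ⊓
        AddMonoidHom.range (G := Additive (Affine.SqUnits K)) V.twoIsogenyCodomain.twoIsogenyTorsorHom) = 2 ^ n ∧
      Even (V.twoIsogenyCodomain.shaCorank 2 + m + n) := by
  haveI : Fact (Nat.Prime 2) := ⟨Nat.prime_two⟩
  -- `φ ψ = 2` from `ψ φ = 2` and the surjectivity of `φ`
  have hφψ : ∀ Q : V.twoIsogenyCodomain.geomPoints, V.twoIsogenyGeomHom (ψ Q) = (2 : ℤ) • Q := by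
    intro Q
    obtain ⟨P, rfl⟩ := V.twoIsogenyGeomHom_surjective Q
    rw [hψ, map_zsmul]
  obtain ⟨m, n, hm, hn, hmn⟩ := exists_natCard_ker_shaMap_even_shaCorank 2 habs
    V.twoIsogenyGeomHom (twoIsogenyGeomHom_smul V) V.twoIsogeny.hasLocalPointsMaps_toAddMonoidHom
    ψ hψs hlocψ (fun P ↦ by exact_mod_cast hψ P) (fun Q ↦ by exact_mod_cast hφψ Q)
    B B' hB hB' hBker hB'ker hadj
  refine ⟨m, n, ?_, ?_, hmn⟩
  · rw [← hm]
    exact natCard_sha_inf_range_twoIsogenyTorsorHom_eq V V.twoIsogeny.hasLocalPointsMaps_toAddMonoidHom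
  · rw [← hn, natCard_sha_inf_range_twoIsogenyTorsorHom_eq V.twoIsogenyCodomain
      V.twoIsogenyCodomain.twoIsogeny.hasLocalPointsMaps_toAddMonoidHom,
      ← ker_shaMap_eq_of_comp_twoIsogeny ψ hψs (fun P ↦ ?_) hlocψ
        V.twoIsogenyCodomain.twoIsogeny.hasLocalPointsMaps_toAddMonoidHom]
    rw [hψ, ← natCast_zsmul]
    rfl

end General

/-! ## Over `ℚ`: Cassels' parity formula from a functorial Cassels–Tate family -/

section Rat

/-- Sign bookkeeping: `Even (c + m + n)` gives `(-1)^c = (-1)^(m + n)`. [folklore] -/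
theorem neg_one_pow_eq_of_even_add {c m n : ℕ} (h : Even (c + m + n)) :
    (-1 : ℤ) ^ c = (-1 : ℤ) ^ (m + n) := by
  obtain ⟨r, hr⟩ := h
  have h1 : (-1 : ℤ) ^ c * (-1 : ℤ) ^ (m + n) = 1 := by
    rw [← pow_add, show c + (m + n) = 2 * r by omega, pow_mul]
    norm_num
  have h2 : (-1 : ℤ) ^ (m + n) * (-1 : ℤ) ^ (m + n) = 1 := by
    rw [← pow_add, ← two_mul, pow_mul]
    norm_num
  calc (-1 : ℤ) ^ c = (-1 : ℤ) ^ c * ((-1 : ℤ) ^ (m + n) * (-1 : ℤ) ^ (m + n)) := by rw [h2, mul_one]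
    _ = ((-1 : ℤ) ^ c * (-1 : ℤ) ^ (m + n)) * (-1 : ℤ) ^ (m + n) := by ring
    _ = (-1 : ℤ) ^ (m + n) := by rw [h1, one_mul]

/-- **Cassels' parity formula for the `2`-isogeny over `ℚ` from a functorial Cassels–Tate family.**
Granted (i) the abstract isogeny-pair parity for `2`-primary groups (`habs`, group theory) and (ii) a
family of bi-additive pairings `⟨·,·⟩_W` on `Ш(W/ℚ)`, alternating with kernel the divisible subgroup for
every elliptic `W` (Cassels 1962, Tate 1963; Milne, *ADT*, I.6.9, I.6.13(a); Silverman, *AEC*, X.4.14 —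
the tree's `exists_casselsTate_pairing`) and functorial, `⟨φ x, y⟩_{W'} = ⟨x, ψ y⟩_W` whenever
`ψ ∘ φ = [deg φ]` (Milne, *ADT*, I, Rem. 6.10(a) with `E^t = E`, `φ^t = φ̂`), the tree's named fact
`cassels_selmerCorank_two_parity` holds: for `E = E_{a,b}`, `b(a² - 4b) ≠ 0`,
`(-1)^{corank Sel_{2^∞}(E/ℚ)} = (-1)^{dim S(a,b) + dim S'(a,b)}` (Dokchitser–Dokchitser, Thm. 30 in the
Selmer-set form of Klagsbrun, Thm. 3.5–3.6). Proof: `cassels_selmerCorank_two_parity_iff_sha_parity` and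
`exists_natCard_sha_inf_range_even_shaCorank` for the half-model `V₀` (`V₀' = E`), with the dual of
`φ₀ = V₀.twoIsogeny` from `Isogeny.exists_dual_of_isElliptic` (`deg φ₀ = 2`).
[cite: DokchitserDokchitser2011Crelle, Thm. 30 (arXiv:0906.1815)] [cite: MilneADT2006, I Prop. 6.9, Rem. 6.10(a), Thm. 6.13(a)] -/
theorem cassels_selmerCorank_two_parity_of_casselsTate_functorial
    (habs : ∀ {A A' : Type} {Q : Type} [AddCommGroup A] [AddCommGroup A'] [AddCommGroup Q]
      (p : ℕ) [Fact p.Prime]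
      (_hA : ∀ a : A, ∃ n : ℕ, p ^ n • a = 0) (_hA' : ∀ a : A', ∃ n : ℕ, p ^ n • a = 0)
      [Finite A[(p : ℤ)]] [Finite A'[(p : ℤ)]]
      (ι : Q[(p : ℤ)] →+ ZMod p) (_hι : Function.Injective ι)
      (B : A →+ A →+ Q) (B' : A' →+ A' →+ Q) (_hB : ∀ x, B x x = 0) (_hB' : ∀ y, B' y y = 0)
      (_hker : ∀ a, (∀ b, B a b = 0) → ∀ k : ℕ, a ∈ (nsmulAddMonoidHom (α := A) (p ^ k)).range)
      (_hker' : ∀ a, (∀ b, B' a b = 0) → ∀ k : ℕ, a ∈ (nsmulAddMonoidHom (α := A') (p ^ k)).range)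
      (f : A →+ A') (g : A' →+ A) (_hgf : ∀ x, g (f x) = p • x) (_hfg : ∀ y, f (g y) = p • y)
      (_hadj : ∀ x y, B' (f x) y = B x (g y)),
      ∃ m n : ℕ, Nat.card f.ker = p ^ m ∧ Nat.card g.ker = p ^ n ∧ Even (zpCorank A' p + m + n))
    (hCT : ∃ B : (W : WeierstrassCurve ℚ) → (W.sha →+ W.sha →+ AddCircle (1 : ℚ)),
      (∀ (W : WeierstrassCurve ℚ) [W.IsElliptic],
        (∀ x, B W x x = 0) ∧ ∀ x, (∀ y, B W x y = 0) ↔ x ∈ AddSubgroup.divisibleElements W.sha) ∧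
      ∀ (W W' : WeierstrassCurve ℚ) [W.IsElliptic] [W'.IsElliptic] (φ : Isogeny W W') (ψ : Isogeny W' W),
        (∀ P, ψ (φ P) = (φ.degree : ℤ) • P) →
        ∀ (x : W.sha) (y : W'.sha),
          B W' (shaMap φ.toAddMonoidHom φ.map_smul φ.hasLocalPointsMaps_toAddMonoidHom x) y =
            B W x (shaMap ψ.toAddMonoidHom ψ.map_smul ψ.hasLocalPointsMaps_toAddMonoidHom y)) :
    cassels_selmerCorank_two_parity := by
  rw [cassels_selmerCorank_two_parity_iff_sha_parity]
  intro a b hab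
  haveI hV₀ := isElliptic_halfModel hab
  haveI hE := isElliptic_mk_of_ne_zero (F := ℚ) hab
  obtain ⟨Bf, hBW, hfun⟩ := hCT
  set V₀ : WeierstrassCurve ℚ := ⟨0, -(a : ℚ) / 2, 0, ((a : ℚ) ^ 2 - 4 * b) / 16, 0⟩ with hV₀def
  obtain ⟨ψ, hψ⟩ := Isogeny.exists_dual_of_isElliptic V₀.twoIsogeny
  have hψ2 : ∀ P : V₀.geomPoints, ψ.toAddMonoidHom (V₀.twoIsogenyGeomHom P) = (2 : ℤ) • P := by
    intro P
    have h := hψ P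
    rw [degree_twoIsogeny] at h
    exact h
  obtain ⟨m, n, hm, hn, hmn⟩ := exists_natCard_sha_inf_range_even_shaCorank habs ψ.toAddMonoidHom
    ψ.map_smul ψ.hasLocalPointsMaps_toAddMonoidHom hψ2 (Bf V₀) (Bf V₀.twoIsogenyCodomain)
    (hBW V₀).1 (hBW V₀.twoIsogenyCodomain).1 (fun x hx ↦ ((hBW V₀).2 x).mp hx)
    (fun x hx ↦ ((hBW V₀.twoIsogenyCodomain).2 x).mp hx)
    (hfun V₀ V₀.twoIsogenyCodomain V₀.twoIsogeny ψ hψ)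
  have hE' : V₀.twoIsogenyCodomain = ⟨0, (a : ℚ), 0, (b : ℚ), 0⟩ := twoIsogenyCodomain_halfModel a b
  rw [natCard_sha_inf_range_twoIsogenyTorsorHom_congr hE'] at hn
  rw [shaCorank_congr hE'] at hmn
  rw [hm, hn, ← pow_add, Nat.log_pow Nat.one_lt_two]
  exact neg_one_pow_eq_of_even_add hmn

/-! ### The group theory discharged: the abstract isogeny-pair parity, unconditionally -/

universe w₁ w₂ in
/-- **The abstract isogeny-pair parity** for `p`-primary groups with finite `p`-torsion — the tree's
`exists_natCard_ker_even_zpCorank_of_adjoint` (p-primary reduction) fed with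
`Literature.GroupTheory.FiniteAbelian.exists_natCard_ker_eq_pow_and_even_of_adjoint` (finite level) and
`pow_zpCorank_eq_natCard_torsionBy_inf_range_of_stable` (the corank of a stable `p`-primary group):
`A, A'` `p`-primary with finite `p`-torsion, alternating pairings with `p^∞`-divisible left kernels,
`g f = p`, `f g = p`, adjoint ⇒ `#ker f = p^m`, `#ker g = p^n`, `zpCorank A' p + m + n` even. [folklore] -/
theorem isogenyPairParity
    {A A' : Type w₁} {Q : Type w₂} [AddCommGroup A] [AddCommGroup A'] [AddCommGroup Q]
    (p : ℕ) [Fact p.Prime]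
    (hA : ∀ a : A, ∃ n : ℕ, p ^ n • a = 0) (hA' : ∀ a : A', ∃ n : ℕ, p ^ n • a = 0)
    [Finite A[(p : ℤ)]] [Finite A'[(p : ℤ)]]
    (ι : Q[(p : ℤ)] →+ ZMod p) (hι : Function.Injective ι)
    (B : A →+ A →+ Q) (B' : A' →+ A' →+ Q) (hB : ∀ x, B x x = 0) (hB' : ∀ y, B' y y = 0)
    (hker : ∀ a, (∀ b, B a b = 0) → ∀ k : ℕ, a ∈ (nsmulAddMonoidHom (α := A) (p ^ k)).range)
    (hker' : ∀ a, (∀ b, B' a b = 0) → ∀ k : ℕ, a ∈ (nsmulAddMonoidHom (α := A') (p ^ k)).range)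
    (f : A →+ A') (g : A' →+ A) (hgf : ∀ x, g (f x) = p • x) (hfg : ∀ y, f (g y) = p • y)
    (hadj : ∀ x y, B' (f x) y = B x (g y)) :
    ∃ m n : ℕ, Nat.card f.ker = p ^ m ∧ Nat.card g.ker = p ^ n ∧ Even (zpCorank A' p + m + n) :=
  exists_natCard_ker_even_zpCorank_of_adjoint
    (fun p _ hT hT' ι hι b b' hb hb' hbnd hb'nd f g hgf hfg hadj ↦
      Literature.GroupTheory.FiniteAbelian.exists_natCard_ker_eq_pow_and_even_of_adjoint p hT hT' ι hι
        b b' hb hb' hbnd hb'nd f g hgf hfg hadj)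
    (fun p _ hA _ _ hst ↦ pow_zpCorank_eq_natCard_torsionBy_inf_range_of_stable p hA hst)
    p hA hA' ι hι B B' hB hB' hker hker' f g hgf hfg hadj

/-- **Cassels' parity formula for the `2`-isogeny over `ℚ` from a functorial Cassels–Tate family**, with
the group theory discharged (`isogenyPairParity`): the only hypothesis is the functorial family of
Cassels–Tate pairings over `ℚ` (the body of the named fact `casselsTate_pairing_functorial ℚ`).
[cite: DokchitserDokchitser2011Crelle, Thm. 30 (arXiv:0906.1815)] -/
theorem cassels_selmerCorank_two_parity_of_casselsTate_functorial'
    (hCT : ∃ B : (W : WeierstrassCurve ℚ) → (W.sha →+ W.sha →+ AddCircle (1 : ℚ)),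
      (∀ (W : WeierstrassCurve ℚ) [W.IsElliptic],
        (∀ x, B W x x = 0) ∧ ∀ x, (∀ y, B W x y = 0) ↔ x ∈ AddSubgroup.divisibleElements W.sha) ∧
      ∀ (W W' : WeierstrassCurve ℚ) [W.IsElliptic] [W'.IsElliptic] (φ : Isogeny W W') (ψ : Isogeny W' W),
        (∀ P, ψ (φ P) = (φ.degree : ℤ) • P) →
        ∀ (x : W.sha) (y : W'.sha),
          B W' (shaMap φ.toAddMonoidHom φ.map_smul φ.hasLocalPointsMaps_toAddMonoidHom x) y =
            B W x (shaMap ψ.toAddMonoidHom ψ.map_smul ψ.hasLocalPointsMaps_toAddMonoidHom y)) :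
    cassels_selmerCorank_two_parity :=
  cassels_selmerCorank_two_parity_of_casselsTate_functorial
    (fun p _ hA hA' _ _ ι hι B B' hB hB' hker hker' f g hgf hfg hadj ↦
      isogenyPairParity p hA hA' ι hι B B' hB hB' hker hker' f g hgf hfg hadj) hCT

/-- **Cassels' parity formula for the `2`-isogeny over `ℚ` from the named fact
`casselsTate_pairing_functorial ℚ`** (the Cassels–Tate pairing as a functorial family; Milne, *ADT*, I,
Prop. 6.9, Rem. 6.10(a), Thm. 6.13(a)): the tree's named fact `cassels_selmerCorank_two_parity` reduced to
that one (appended 2026-08-16 once `CasselsTatePairingFunctorial.lean` landed).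
[cite: DokchitserDokchitser2011Crelle, Thm. 30 (arXiv:0906.1815)] -/
theorem cassels_selmerCorank_two_parity_of_casselsTate_pairing_functorial
    (h : casselsTate_pairing_functorial ℚ) : cassels_selmerCorank_two_parity :=
  cassels_selmerCorank_two_parity_of_casselsTate_functorial' h

end Rat

end Literature.NumberTheory.EllipticCurves

end
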